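import Mathlib
import HarnessLib
import Summits.Parity.Statement
import Summits.Parity.GeneralizedHardyLittlewood.Theses.SiegelSpectrumSplit
import Summits.Parity.GeneralizedHardyLittlewood.Theses.ShiftedPrimeFactor
import Summits.Parity.GeneralizedHardyLittlewood.Theorems.GhostBoundaryCarvingTwoOfThreeNecessity
import Literature.NumberTheory.Sieve.PolymathBoundedGaps
import Literature.NumberTheory.Sieve.LinearEquationsInPrimes
import Literature.NumberTheory.Sieve.ParityWave0

/-!
# Route `ShiftedPrimeFactor`: necessity and exactness of the node on the BORN decls (hand for item `ShiftedLPF`)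

Decomp-parity node G1.2.H «ShiftedPrimeFactor» (lens-3 g5; critic CLEARED HOME/STATUS.md l.282,
CRITIC-LEDGER row 58, precision P2: "staffable Lean = the HAND landing of §3–§4
(`twinSet_infinite_of_weakDHL_two_two`, `twinPrimeConjecture_of_fixedLower`, `shiftedLPF_of_fixedLower`,
`fixedLower_iff`) as `Theorems/ShiftedPrimeFactorNecessity.lean --supports stmt-Parity-26863`"), ported
from the lens kernel `HOME/decomp-parity-lens-3/g5/ShiftedPrimeFactor.lean` (sha256 bbdc2d12… v2) onto the
born route decls `Theses.ShiftedPrimeFactor.ShiftedLPF` / `.FactorLift` and the record leaf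
`Theses.SiegelSpectrumSplit.FixedLower` (stmt-Parity-26863):

* `twinSet_infinite_of_weakDHL_two_two` : `DHL[2,2] →` the twin set is infinite (admissible pair `{0,2}`;
  the barrier file `Literature.Barriers.Parity.MaynardFunctionalCeiling.weakDHL_two_two_twinPrimes` proves the
  `TwinPrimeConjecture` form — restated in set form only to keep this file's import closure inside built modules);
* `twinPrimeConjecture_of_fixedLower` : the record leaf implies the twin prime conjecture (through the landed
  `GhostBoundaryCarving.weakDHL_of_fixedLower`), a typed edge `26863 ⟹ parity.S03` for the census;
* `shiftedLPF_of_fixedLower`, `shiftedLPF_of_ghl`, `pieces_of_ghl` : necessity of the credited notch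
  «P⁺(p+2) > p^(17/25) for infinitely many primes p» from the leaf / the conjunct, hypothesis-free;
* `factorLift_iff` (`Iff.rfl` on the born texts), `fixedLower_iff : FixedLower ↔ ShiftedLPF ∧ FactorLift`
  (the node's exactness in the tree), `node_iff` (modulo the record's necessity `GHL → Q`, the conjunct is
  equivalent to the six binders of the route's `closes`);
* `fixedLower_of_ghl`, `fixedUpper_of_ghl` : the conjunct implies both fixed-pattern halves of the record
  (`L := ⌈‖Ψ‖₁⌉`), typed edges GHL ⟹ 26863 / 26852;
* the four shared items of the route are the record's, by `Iff.rfl` (`boundedSiegelZeroQuality_iff_record`, …).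

Helper file `--supports` the `ShiftedLPF` item (it closes no item: `ShiftedLPF` is open in print at the literal,
arXiv:2602.20917 §2.4; record 0.679, arXiv:2508.18285 Thm 1.1).  0 sorry · standard axioms only · no new `def`.
-/

open scoped BigOperators
open Finset Filter Literature.NumberTheory.Sieve

namespace Summit.Parity.GeneralizedHardyLittlewood.Theses.ShiftedPrimeFactor

open Summit.Parity.GeneralizedHardyLittlewood.Theses.SiegelSpectrumSplit (FixedLower)

/-! ## §1 The shared items are the record's items (same texts) -/

/-- The route's shared item `BoundedSiegelZeroQuality` (stmt-Parity-25148) IS the record's decl (same text). [this route] -/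
theorem boundedSiegelZeroQuality_iff_record :
    BoundedSiegelZeroQuality ↔ SiegelSpectrumSplit.BoundedSiegelZeroQuality := Iff.rfl

/-- The route's shared item `FixedUpper` (stmt-Parity-26852) IS the record's decl (same text). [this route] -/
theorem fixedUpper_iff_record : FixedUpper ↔ SiegelSpectrumSplit.FixedUpper := Iff.rfl

/-- The route's shared item `UniformUpperGivenFixed` (stmt-Parity-26853) IS the record's decl (same text). [this route] -/
theorem uniformUpperGivenFixed_iff_record :
    UniformUpperGivenFixed ↔ SiegelSpectrumSplit.UniformUpperGivenFixed := Iff.rfl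

/-- The route's shared item `UniformLowerGivenFixed` (stmt-Parity-26864) IS the record's decl (same text). [this route] -/
theorem uniformLowerGivenFixed_iff_record :
    UniformLowerGivenFixed ↔ SiegelSpectrumSplit.UniformLowerGivenFixed := Iff.rfl

/-- The residual is literally «notch → record leaf 26863». -/
theorem factorLift_iff : FactorLift ↔ (ShiftedLPF → FixedLower) := Iff.rfl

/-! ## §2 The dial's top is the twin face -/

/-- A prime factor `q > p` of `p + 2` is `p + 2` (`q = p + 1` would divide `1`): the `θ = 1` end of the
Chebyshev–Hooley dial «`p + 2` has a prime factor `> p ^ θ`» is the twin set. -/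
theorem setOf_lpf_one_eq_twinSet :
    {p : ℕ | p.Prime ∧ ∃ q : ℕ, q.Prime ∧ q ∣ p + 2 ∧ (p : ℝ) ^ (1 : ℝ) < (q : ℝ)}
      = {p : ℕ | p.Prime ∧ (p + 2).Prime} := by
  ext p
  simp only [Set.mem_setOf_eq, Real.rpow_one, Nat.cast_lt]
  constructor
  · rintro ⟨hp, q, hq, hqd, hlt⟩
    have hle : q ≤ p + 2 := Nat.le_of_dvd (by omega) hqd
    obtain rfl | rfl : q = p + 1 ∨ q = p + 2 := by omega
    · exfalso
      have h1 : p + 1 ∣ 1 := (Nat.dvd_add_right (dvd_refl (p + 1))).mp hqd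
      have h2 := Nat.le_of_dvd one_pos h1
      have h3 := hp.two_le
      omega
    · exact ⟨hp, hq⟩
  · rintro ⟨hp, hp2⟩
    exact ⟨hp, p + 2, hp2, dvd_rfl, by omega⟩

/-- The dial is antitone in `θ`: a larger exponent gives a smaller set (`p ≥ 2 > 1`). -/
theorem setOf_lpf_anti {θ θ' : ℝ} (h : θ ≤ θ') :
    {p : ℕ | p.Prime ∧ ∃ q : ℕ, q.Prime ∧ q ∣ p + 2 ∧ (p : ℝ) ^ θ' < (q : ℝ)}
      ⊆ {p : ℕ | p.Prime ∧ ∃ q : ℕ, q.Prime ∧ q ∣ p + 2 ∧ (p : ℝ) ^ θ < (q : ℝ)} := by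
  rintro p ⟨hp, q, hq, hqd, hlt⟩
  refine ⟨hp, q, hq, hqd, lt_of_le_of_lt ?_ hlt⟩
  exact Real.rpow_le_rpow_of_exponent_le (by exact_mod_cast hp.one_lt.le) h

/-- Twin primes give the notch (indeed every rung `θ ≤ 1`). -/
theorem shiftedLPF_of_twinPrimeConjecture (h : TwinPrimeConjecture) : ShiftedLPF := by
  have h1 : {p : ℕ | p.Prime ∧ (p + 2).Prime}.Infinite := by
    -- set form of the tree's `TwinPrimeConjecture` (cf. `twinPrimeConjecture_iff_setOf_infinite`)
    rw [Set.infinite_iff_exists_gt]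
    intro n
    obtain ⟨p, hnp, hp, hp2⟩ := h n
    exact ⟨p, ⟨hp, hp2⟩, hnp⟩
  rw [← setOf_lpf_one_eq_twinSet] at h1
  exact h1.mono (setOf_lpf_anti (by norm_num))

/-! ## §3 Necessity from the leaf, the conjunct and the root -/

/-- `DHL[2, 2]` gives infinitely many twin primes, via the admissible pair `{0, 2}`
(`isAdmissibleTuple_pair`; cf. `Literature.Barriers.Parity.MaynardFunctionalCeiling.weakDHL_two_two_twinPrimes`).
[cite: Polymath8b2014, Claim 3.1] -/
theorem twinSet_infinite_of_weakDHL_two_two (h : WeakDicksonHardyLittlewood 2 2) :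
    {p : ℕ | p.Prime ∧ (p + 2).Prime}.Infinite := by
  have hfr := h ({0, 2} : Finset ℤ) isAdmissibleTuple_pair (by decide)
  refine Nat.frequently_atTop_iff_infinite.mp (hfr.mono fun n hcard => ?_)
  have hsub : ({0, 2} : Finset ℤ).filter
      (fun h ↦ 0 < (n : ℤ) + h ∧ ((n : ℤ) + h).toNat.Prime) = {0, 2} :=
    Finset.eq_of_subset_of_card_le (Finset.filter_subset _ _) (by simpa using hcard)
  have h0 : (0 : ℤ) ∈ ({0, 2} : Finset ℤ).filter
      (fun h ↦ 0 < (n : ℤ) + h ∧ ((n : ℤ) + h).toNat.Prime) := by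
    rw [hsub]; simp
  have h2 : (2 : ℤ) ∈ ({0, 2} : Finset ℤ).filter
      (fun h ↦ 0 < (n : ℤ) + h ∧ ((n : ℤ) + h).toNat.Prime) := by
    rw [hsub]; simp
  rw [Finset.mem_filter] at h0 h2
  have e0 : ((n : ℤ) + 0).toNat = n := by omega
  have e2 : ((n : ℤ) + 2).toNat = n + 2 := by omega
  exact ⟨by simpa [e0] using h0.2.2, by simpa [e2] using h2.2.2⟩

/-- **The record leaf implies the twin prime conjecture**: `FixedLower → DHL[2,2]` (landed
`GhostBoundaryCarving.weakDHL_of_fixedLower`) and `DHL[2,2] →` twins.  Typed edge 26863 ⟹ parity.S03. -/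
theorem twinPrimeConjecture_of_fixedLower (hFL : FixedLower) : TwinPrimeConjecture := by
  have hinf := twinSet_infinite_of_weakDHL_two_two
    (Summit.Parity.GeneralizedHardyLittlewood.Theses.GhostBoundaryCarving.weakDHL_of_fixedLower hFL 2)
  intro n
  obtain ⟨p, ⟨hp, hp2⟩, hnp⟩ := (Set.infinite_iff_exists_gt.mp hinf) n
  exact ⟨p, hnp, hp, hp2⟩

/-- **Necessity from the leaf** (edge 26863 → `ShiftedLPF`). -/
theorem shiftedLPF_of_fixedLower (hFL : FixedLower) : ShiftedLPF :=
  shiftedLPF_of_twinPrimeConjecture (twinPrimeConjecture_of_fixedLower hFL)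

/-- `‖Ψ‖_N` is non-increasing in `N`. [cite: GreenTao2010, (1.1)] -/
theorem affLinSize_anti {d t : ℕ} (Ψ : Fin t → AffLinForm d) {N N' : ℝ} (hN : 0 < N)
    (hNN' : N ≤ N') : affLinSize Ψ N' ≤ affLinSize Ψ N := by
  unfold affLinSize
  refine add_le_add le_rfl (Finset.sum_le_sum fun i _ => ?_)
  rw [abs_div, abs_div, abs_of_pos hN, abs_of_pos (lt_of_lt_of_le hN hNN')]
  exact div_le_div_of_nonneg_left (abs_nonneg _) hN hNN'

/-- **The conjunct implies the record leaf** (`L := ⌈‖Ψ‖₁⌉`): typed edge GHL ⟹ 26863. [cite: GreenTao2010, Conj. 1.2] -/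
theorem fixedLower_of_ghl (h : _root_.GeneralizedHardyLittlewood) : FixedLower := by
  intro d t hd ht Ψ hΨ ε hε
  obtain ⟨N₀, hN₀⟩ := h d t ⌈affLinSize Ψ 1⌉₊ hd ht ε hε
  refine ⟨max N₀ 1, fun N hN K hK hKN => ?_⟩
  have hN1 : (1 : ℝ) ≤ N := by exact_mod_cast le_of_max_le_right hN
  have hLN : affLinSize Ψ N ≤ (⌈affLinSize Ψ 1⌉₊ : ℕ) :=
    (affLinSize_anti Ψ one_pos hN1).trans (Nat.le_ceil _)
  exact (abs_sub_le_iff.mp (hN₀ N (le_of_max_le_left hN) Ψ hΨ hLN K hK hKN)).2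

/-- **The conjunct implies the record's upper leaf** (`L := ⌈‖Ψ‖₁⌉`): typed edge GHL ⟹ 26852. [cite: GreenTao2010, Conj. 1.2] -/
theorem fixedUpper_of_ghl (h : _root_.GeneralizedHardyLittlewood) : FixedUpper := by
  intro d t hd ht Ψ hΨ ε hε
  obtain ⟨N₀, hN₀⟩ := h d t ⌈affLinSize Ψ 1⌉₊ hd ht ε hε
  refine ⟨max N₀ 1, fun N hN K hK hKN => ?_⟩
  have hN1 : (1 : ℝ) ≤ N := by exact_mod_cast le_of_max_le_right hN
  have hLN : affLinSize Ψ N ≤ (⌈affLinSize Ψ 1⌉₊ : ℕ) :=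
    (affLinSize_anti Ψ one_pos hN1).trans (Nat.le_ceil _)
  exact (abs_sub_le_iff.mp (hN₀ N (le_of_max_le_left hN) Ψ hΨ hLN K hK hKN)).1

/-- The uniform upper half is a conjunct of GHL. -/
theorem uniformUpperGivenFixed_of_ghl (h : _root_.GeneralizedHardyLittlewood) :
    UniformUpperGivenFixed := by
  intro _ _ d t L hd ht ε hε
  obtain ⟨N₀, hN₀⟩ := h d t L hd ht ε hε
  exact ⟨N₀, fun N hN Ψ hΨ hL K hK hKN => (abs_sub_le_iff.mp (hN₀ N hN Ψ hΨ hL K hK hKN)).1⟩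

/-- The uniform lower half is a conjunct of GHL. -/
theorem uniformLowerGivenFixed_of_ghl (h : _root_.GeneralizedHardyLittlewood) :
    UniformLowerGivenFixed := by
  intro _ _ d t L hd ht ε hε
  obtain ⟨N₀, hN₀⟩ := h d t L hd ht ε hε
  exact ⟨N₀, fun N hN Ψ hΨ hL K hK hKN => (abs_sub_le_iff.mp (hN₀ N hN Ψ hΨ hL K hK hKN)).2⟩

/-- **Necessity from the conjunct**, hypothesis-free. -/
theorem shiftedLPF_of_ghl (h : _root_.GeneralizedHardyLittlewood) : ShiftedLPF :=
  shiftedLPF_of_fixedLower (fixedLower_of_ghl h)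

/-- **Necessity from the root** `Parity`, hypothesis-free. -/
theorem shiftedLPF_of_parity (h : Parity) : ShiftedLPF := shiftedLPF_of_ghl h.2

/-! ## §4 Exactness, trivial branches, the node modulo `GHL → Q` -/

/-- Costume branch: the residual holds whenever the leaf does. -/
theorem factorLift_of_fixedLower (h : FixedLower) : FactorLift := fun _ => h

/-- Trivial branch: the residual holds vacuously if the notch fails. -/
theorem factorLift_of_not_shiftedLPF (h : ¬ ShiftedLPF) : FactorLift := fun hS => (h hS).elim

/-- Glue: pieces ⟹ leaf. -/
theorem fixedLower_of_pieces (hS : ShiftedLPF) (hF : FactorLift) : FixedLower := hF hS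

/-- **Exactness of the node**: `FixedLower ⟺ ShiftedLPF ∧ FactorLift`. -/
theorem fixedLower_iff : FixedLower ↔ ShiftedLPF ∧ FactorLift :=
  ⟨fun h => ⟨shiftedLPF_of_fixedLower h, factorLift_of_fixedLower h⟩, fun h => fixedLower_of_pieces h.1 h.2⟩

/-- Given the notch, the residual contracts to the leaf. -/
theorem factorLift_iff_fixedLower_of_shiftedLPF (hS : ShiftedLPF) : FactorLift ↔ FixedLower :=
  ⟨fun hF => hF hS, factorLift_of_fixedLower⟩

/-- Both pieces from the conjunct, hypothesis-free. -/
theorem pieces_of_ghl (h : _root_.GeneralizedHardyLittlewood) : ShiftedLPF ∧ FactorLift :=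
  fixedLower_iff.mp (fixedLower_of_ghl h)

/-- Both pieces from the root, hypothesis-free. -/
theorem pieces_of_parity (h : Parity) : ShiftedLPF ∧ FactorLift := pieces_of_ghl h.2

/-- **`node_iff`**: modulo the record's own necessity `GHL → Q` (SiegelSpectrumSplit files `Q` as a crux of
GHL), the conjunct is EQUIVALENT to the six binders of the route's `closes`. -/
theorem node_iff (hQ_of_ghl : _root_.GeneralizedHardyLittlewood → BoundedSiegelZeroQuality) :
    _root_.GeneralizedHardyLittlewood ↔
      (BoundedSiegelZeroQuality ∧ FixedUpper ∧ UniformUpperGivenFixed ∧ ShiftedLPF ∧ FactorLift ∧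
        UniformLowerGivenFixed) :=
  ⟨fun h => ⟨hQ_of_ghl h, fixedUpper_of_ghl h, uniformUpperGivenFixed_of_ghl h, shiftedLPF_of_ghl h,
      factorLift_of_fixedLower (fixedLower_of_ghl h), uniformLowerGivenFixed_of_ghl h⟩,
    fun h => closes h.1 h.2.1 h.2.2.1 h.2.2.2.1 h.2.2.2.2.1 h.2.2.2.2.2⟩

end Summit.Parity.GeneralizedHardyLittlewood.Theses.ShiftedPrimeFactor
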